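import Literature.NumberTheory.LFunctions.ElementaryDeuringHeilbronnPhenomenon
import HarnessLib

/-!
# The Heilbronn phenomenon with explicit constants by elementary methods (Pintz 1976, part IV):
# a zero `1 − γ + it` of any `L(s, χ_k)` with `γ < 0.05` forces `L(1, χ_D) > 1/(140 U^{6γ} log³U)`
# and `δ > 1/(140 U^{6γ} log⁵U)`, `U = k|s₀|D`; at most one primitive real character vanishes in
# `[1 − min(ε, 1/(140·32 log⁵D·D^{12ε})), 1]`; Tatuzawa's theorems re-derived — AS PRINTED

Topic `Literature/NumberTheory/LFunctions` (namespace `Literature.NumberTheory.LFunctions`).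
STATEMENT LAYER (D-0014) typed for the cell `parity-realchar` (SIEGEL INSTRUMENT, conditionals column
topic I.8 «Deuring–Heilbronn repulsion, explicit» — here in `L(1)`- and `δ`-currency with the PRINTED
constants `1/140`, `6γ`, `140·32`, `12ε`, next to Bellotti–Puglisi 2023's wider range `γ < 1/4` with
an inexplicit `c₁` (`ElementaryDeuringHeilbronnPhenomenon.lean`, whose vocabulary
`BellottiPuglisi2023.ProductNonprincipal` is reused) — and topic I.1 «class numbers» (Theorem 5)) and
cc `landau-siegel` (§C). Source: J. Pintz, *Elementary methods in the theory of L-functions, IV. The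
Heilbronn phenomenon*, Acta Arith. **31** (1976) 419–429 [Pintz1976ElementaryIV]; the journal scan
(`matwbn.icm.edu.pl/ksiazki/aa/aa31/aa31410.pdf`, corpus key `paper:url-cc73a1eeb1bc`) was rendered
page by page and READ (pp. 419–428), 2026-08-27.

## What the source prints (verbatim)

p. 422: "In our theorems we shall assume without any further reference that `D` (but not `k`) is
greater than a given effective constant `D₀` (computable from the proofs). First we state
**THEOREM 1.** Let us assume that an `L`-function belonging to a non-principal (real or complex)
character `χ_k mod k` has an `s₀ = 1 − γ + it` zero with `γ < 0.05`. Then for an arbitrary real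
non-principal character `χ_D mod D` (for which `χ_kχ_D` is also non-principal) the inequality
(2.1) `L(1, χ_D) > 1/(140 U^{6γ} log³ U)` holds, where `U = k|s₀|D`."
p. 423: "**THEOREM 2.** If an `L` function belonging to a non-principal character `χ_k mod k` has an
`s₀ = 1 − γ + it` zero with `γ < 0.05`, and an other `L`-function belonging to the real non-principal
character `χ_D` (for which `χ_kχ_D` is also non-principal) `mod D` has an `1 − δ` real exceptional
zero, then the inequality (2.2) `δ > 1/(140 U^{6γ} log⁵ U)` holds, where `U = k|s₀|D`. [...]
**THEOREM 3.** For an arbitrary `ε`, `0 < ε < 0.05`, there is at most one `D`, and at most one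
primitive real character `χ_D mod D`, such that `L(s, χ_D)` vanishes somewhere in the interval (2.5)
`[1 − min(ε, 1/(140·32 log⁵D·D^{12ε})), 1]`. [...] **THEOREM 4.** For an arbitrary `ε > 0` there
is a `D₀(ε)` effective constant depending only on `ε`, with the following property: if `χ_D` is a
real primitive character `mod D`, and `D > D₀(ε)` then (2.6) `L(s, χ_D) ≠ 0` for `s ∈ [1 − D^{−ε}, 1]`
and the inequality (2.7) `L(1, χ_D) > D^{−ε}` holds, with the possible exception of at most one `D`,
and at most one primitive character `χ_D mod D`."
p. 424: "**THEOREM 5.** For an arbitrary `ε > 0` there is a `D₁(ε)` effective constant with the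
following property: If `D ≥ D₁(ε)` (and `−D < 0` is a fundamental discriminant) then the inequality
(2.8) `h(−D) > D^{1/2−ε}` holds, with the possible exception of at most one negative fundamental
discriminant. If `−D` is a negative fundamental discriminant, `h` an arbitrary natural number,
`D > Ch² log²(3h)` (`C` is an absolute effective constant), then the inequality (2.9) `h(−D) > h`
holds, with the possible exception of at most one negative fundamental discriminant."

## How it is typed

* The standing "`D > D₀` (effective, absolute)" is an explicit `∃ D₀` in each fact; the constants
  `1/140`, `6γ`, `log³U`/`log⁵U`, `140·32`, `12ε` are verbatim. `L(1, χ_D)` is real for real `χ_D`: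
  `(χD.LFunction 1).re`. "`χ_kχ_D` non-principal" = `BellottiPuglisi2023.ProductNonprincipal` (the
  product lifted to modulus `kD` is `≠ 1`). "real exceptional zero `1 − δ`" = any real zero with
  `δ > 0` (the proof, (4.1), bounds the greatest one; the others are farther from `1`).
* Theorem 3's "at most one `D` and at most one primitive real character" across moduli = equal
  moduli and equal values on `ℕ` (as in `bellottiPuglisi2023_corollary3`), among `D > D₀`.
* Theorem 4's "with the possible exception of at most one `D`, and at most one primitive `χ_D`" is
  rendered pairwise: of two distinct primitive real characters (any moduli `> D₀(ε)`), at least one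
  satisfies (2.6) ∧ (2.7) — the shape of `SiegelTatuzawa.AtMostOneException` used pairwise.
* Theorem 5 over imaginary quadratic fields `K` (`−D = d_K`, `h(−D) = h_K`), pairwise in the same
  way (of two fields with distinct discriminants beyond the threshold, at least one obeys the bound);
  the absolute `C` of (2.9) is existential.

## Contents

NAMED FACTS `pintz1976Heilbronn_theorem1` … `pintz1976Heilbronn_theorem5a` (2.8),
`pintz1976Heilbronn_theorem5b` (2.9); PROVED reading `Pintz1976Heilbronn.realZero_gt_of_theorem2`
(Theorem 2 in Tao–Teräväinen's quality vocabulary is left to consumers; here only the trivial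
unpacking that a zero `1 − γ + it` of SOME `L(s,χ_k)` with `γ < 0.05` caps every real zero of every
other real character: `1 − β > 1/(140 U^{6γ} log⁵U)`).

Index only: Theorem (Linnik) p. 422 (1.10)–(1.11) (Linnik's Deuring–Heilbronn theorem with
unspecified `A₁, A₂` — the tree has explicit versions, `ExplicitDeuringHeilbronnDirichlet.lean`); the
remark after Theorem 1 ("a zero in the half-plane `σ > 0.95` implies `h(−D) ≫ D^{1/5}`", footnote:
`σ > 3/4` implies `h(−D) → ∞`); the historical §1.

LABEL (cell rule): instrument / statement layer. WHAT THIS IS NOT: no claim that any `L(s, χ_k)` has a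
zero off the critical line or that any exceptional zero exists; the thresholds `D₀`, `D₀(ε)`, `D₁(ε)`,
`C` are effective in print but not numerically given, so nothing here is a certified numerical range;
nothing bears on parity. No instances, no notation, no axioms.

## References

* [Pintz1976ElementaryIV] J. Pintz, Acta Arith. 31 (1976) 419–429: Theorem 1 p. 422 (2.1);
  Theorems 2–4 p. 423 (2.2)–(2.7); Theorem 5 p. 424 (2.8)–(2.9); proofs §§3–4 pp. 424–428.
* [BellottiPuglisi2023] (the 2023 refinement: `γ < 1/4`, exponent `bγ`, inexplicit `c₁`).
* [Tatuzawa1951] (Theorems 4–5 are Tatuzawa's theorems re-derived; the tree's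
  `tatuzawa1951_theorem2` carries Tatuzawa's sharper printed constant `0.655 ε/k^ε`).
-/

noncomputable section

open Complex Finset

namespace Literature.NumberTheory.LFunctions

open BellottiPuglisi2023 (ProductNonprincipal)

/-- **Pintz 1976 (IV), Theorem 1 (NAMED FACT, as printed, p. 422 (2.1)).** "Let us assume that an
`L`-function belonging to a non-principal (real or complex) character `χ_k mod k` has an
`s₀ = 1 − γ + it` zero with `γ < 0.05`. Then for an arbitrary real non-principal character
`χ_D mod D` (for which `χ_kχ_D` is also non-principal) the inequality `L(1, χ_D) > 1/(140 U^{6γ} log³ U)`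
holds, where `U = k|s₀|D`" — for `D > D₀`, an absolute effective constant (p. 422, standing
assumption), rendered `∃ D₀`. (`γ > 0` automatically: no zeros on `Re s ≥ 1`.) Unproved here (§3).
[cite: Pintz1976ElementaryIV, Theorem 1 p. 422 (2.1)] -/
def pintz1976Heilbronn_theorem1 : Prop :=
  ∃ D₀ : ℕ, ∀ (k : ℕ) [NeZero k] (χk : DirichletCharacter ℂ k), χk ≠ 1 →
    ∀ γ t : ℝ, γ < 0.05 → χk.LFunction (1 - γ + t * Complex.I) = 0 →
      ∀ (D : ℕ) [NeZero D] (χD : DirichletCharacter ℂ D), D₀ < D → χD ≠ 1 → χD.IsQuadratic →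
        ProductNonprincipal χk χD →
          1 / (140 * (((k : ℝ) * ‖(1 - γ + t * Complex.I : ℂ)‖ * D) ^ (6 * γ)) *
              Real.log ((k : ℝ) * ‖(1 - γ + t * Complex.I : ℂ)‖ * D) ^ 3) <
            (χD.LFunction 1).re

/-- **Pintz 1976 (IV), Theorem 2 (NAMED FACT, as printed, p. 423 (2.2)).** Same `χ_k`,
`s₀ = 1 − γ + it`, `γ < 0.05`; if moreover `L(s, χ_D)` (`χ_D` real non-principal mod `D > D₀`,
`χ_kχ_D` non-principal) "has an `1 − δ` real exceptional zero, then the inequality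
`δ > 1/(140 U^{6γ} log⁵ U)` holds, where `U = k|s₀|D`." Rendered for every real zero `1 − δ`,
`δ > 0` (the proof, (4.1), treats the greatest). Unproved here (§4: Theorem 1 + Page's
`L(1)/δ ≤ log²D`). [cite: Pintz1976ElementaryIV, Theorem 2 p. 423 (2.2)] -/
def pintz1976Heilbronn_theorem2 : Prop :=
  ∃ D₀ : ℕ, ∀ (k : ℕ) [NeZero k] (χk : DirichletCharacter ℂ k), χk ≠ 1 →
    ∀ γ t : ℝ, γ < 0.05 → χk.LFunction (1 - γ + t * Complex.I) = 0 →
      ∀ (D : ℕ) [NeZero D] (χD : DirichletCharacter ℂ D), D₀ < D → χD ≠ 1 → χD.IsQuadratic →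
        ProductNonprincipal χk χD →
          ∀ δ : ℝ, 0 < δ → χD.LFunction ((1 - δ : ℝ) : ℂ) = 0 →
            1 / (140 * (((k : ℝ) * ‖(1 - γ + t * Complex.I : ℂ)‖ * D) ^ (6 * γ)) *
                Real.log ((k : ℝ) * ‖(1 - γ + t * Complex.I : ℂ)‖ * D) ^ 5) < δ

/-- **Pintz 1976 (IV), Theorem 3 (NAMED FACT, as printed, p. 423 (2.5)).** "For an arbitrary `ε`,
`0 < ε < 0.05`, there is at most one `D`, and at most one primitive real character `χ_D mod D`, such
that `L(s, χ_D)` vanishes somewhere in the interval `[1 − min(ε, 1/(140·32 log⁵D·D^{12ε})), 1]`."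
Among moduli `D > D₀` (p. 422); "the same" = equal moduli and equal values. Unproved here (from
Theorem 2, p. 426–427). [cite: Pintz1976ElementaryIV, Theorem 3 p. 423 (2.5)] -/
def pintz1976Heilbronn_theorem3 : Prop :=
  ∃ D₀ : ℕ, ∀ ε : ℝ, 0 < ε → ε < 0.05 →
    ∀ (D₁ : ℕ) [NeZero D₁] (χ₁ : DirichletCharacter ℂ D₁) (D₂ : ℕ) [NeZero D₂]
      (χ₂ : DirichletCharacter ℂ D₂), D₀ < D₁ → D₀ < D₂ →
      χ₁.IsQuadratic → χ₁.IsPrimitive → χ₁ ≠ 1 → χ₂.IsQuadratic → χ₂.IsPrimitive → χ₂ ≠ 1 →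
      (∃ σ₁ : ℝ, 1 - min ε (1 / (140 * 32 * Real.log D₁ ^ 5 * (D₁ : ℝ) ^ (12 * ε))) ≤ σ₁ ∧
          σ₁ ≤ 1 ∧ χ₁.LFunction (σ₁ : ℂ) = 0) →
      (∃ σ₂ : ℝ, 1 - min ε (1 / (140 * 32 * Real.log D₂ ^ 5 * (D₂ : ℝ) ^ (12 * ε))) ≤ σ₂ ∧
          σ₂ ≤ 1 ∧ χ₂.LFunction (σ₂ : ℂ) = 0) →
        D₁ = D₂ ∧ ∀ n : ℕ, χ₁ (n : ZMod D₁) = χ₂ (n : ZMod D₂)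

/-- **Pintz 1976 (IV), Theorem 4 (NAMED FACT, as printed, p. 423 (2.6)–(2.7); Tatuzawa's theorem
re-derived).** "For an arbitrary `ε > 0` there is a `D₀(ε)` effective constant depending only on `ε`,
with the following property: if `χ_D` is a real primitive character `mod D`, and `D > D₀(ε)` then
`L(s, χ_D) ≠ 0` for `s ∈ [1 − D^{−ε}, 1]` and the inequality `L(1, χ_D) > D^{−ε}` holds, with the
possible exception of at most one `D`, and at most one primitive character `χ_D mod D`." Rendered
pairwise: of two primitive real characters beyond `D₀(ε)` that are not the same (different moduli or
different values), at least one satisfies both conclusions. Unproved here (p. 427).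
[cite: Pintz1976ElementaryIV, Theorem 4 p. 423 (2.6)–(2.7)] -/
def pintz1976Heilbronn_theorem4 : Prop :=
  ∀ ε : ℝ, 0 < ε → ∃ D₀ : ℕ,
    ∀ (D₁ : ℕ) [NeZero D₁] (χ₁ : DirichletCharacter ℂ D₁) (D₂ : ℕ) [NeZero D₂]
      (χ₂ : DirichletCharacter ℂ D₂), D₀ < D₁ → D₀ < D₂ →
      χ₁.IsQuadratic → χ₁.IsPrimitive → χ₁ ≠ 1 → χ₂.IsQuadratic → χ₂.IsPrimitive → χ₂ ≠ 1 →
      ¬ (D₁ = D₂ ∧ ∀ n : ℕ, χ₁ (n : ZMod D₁) = χ₂ (n : ZMod D₂)) →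
        ((∀ σ : ℝ, 1 - (D₁ : ℝ) ^ (-ε) ≤ σ → σ ≤ 1 → χ₁.LFunction (σ : ℂ) ≠ 0) ∧
            (D₁ : ℝ) ^ (-ε) < (χ₁.LFunction 1).re) ∨
        ((∀ σ : ℝ, 1 - (D₂ : ℝ) ^ (-ε) ≤ σ → σ ≤ 1 → χ₂.LFunction (σ : ℂ) ≠ 0) ∧
            (D₂ : ℝ) ^ (-ε) < (χ₂.LFunction 1).re)

/-- **Pintz 1976 (IV), Theorem 5, first part (NAMED FACT, as printed, p. 424 (2.8)).** "For an
arbitrary `ε > 0` there is a `D₁(ε)` effective constant with the following property: If `D ≥ D₁(ε)`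
(and `−D < 0` is a fundamental discriminant) then the inequality `h(−D) > D^{1/2−ε}` holds, with the
possible exception of at most one negative fundamental discriminant." Rendered pairwise over
imaginary quadratic fields (`−D = d_K`, `h(−D) = h_K`): of two fields with distinct discriminants
`≤ −D₁(ε)`, at least one obeys (2.8). Unproved here.
[cite: Pintz1976ElementaryIV, Theorem 5 p. 424 (2.8)] -/
def pintz1976Heilbronn_theorem5a : Prop :=
  ∀ ε : ℝ, 0 < ε → ∃ D₁ : ℕ, ∀ (K₁ : Type) [Field K₁] [NumberField K₁] (K₂ : Type) [Field K₂]
    [NumberField K₂], Module.finrank ℚ K₁ = 2 → Module.finrank ℚ K₂ = 2 →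
    NumberField.discr K₁ < 0 → NumberField.discr K₂ < 0 →
    D₁ ≤ (NumberField.discr K₁).natAbs → D₁ ≤ (NumberField.discr K₂).natAbs →
    NumberField.discr K₁ ≠ NumberField.discr K₂ →
      ((NumberField.discr K₁).natAbs : ℝ) ^ (1 / 2 - ε) < (NumberField.classNumber K₁ : ℝ) ∨
      ((NumberField.discr K₂).natAbs : ℝ) ^ (1 / 2 - ε) < (NumberField.classNumber K₂ : ℝ)

/-- **Pintz 1976 (IV), Theorem 5, second part (NAMED FACT, as printed, p. 424 (2.9); the effective
class-number-`h` bound of Landau–Tatuzawa shape).** "If `−D` is a negative fundamental discriminant,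
`h` an arbitrary natural number, `D > Ch² log²(3h)` (`C` is an absolute effective constant), then the
inequality `h(−D) > h` holds, with the possible exception of at most one negative fundamental
discriminant." Rendered with `∃ C` and pairwise over imaginary quadratic fields (of two fields with
distinct discriminants and `D > C h² log²(3h)`, at least one has class number `> h`). Unproved here
(p. 427–428, (4.4)–(4.9)). [cite: Pintz1976ElementaryIV, Theorem 5 p. 424 (2.9)] -/
def pintz1976Heilbronn_theorem5b : Prop :=
  ∃ C : ℝ, ∀ h : ℕ, 1 ≤ h → ∀ (K₁ : Type) [Field K₁] [NumberField K₁] (K₂ : Type) [Field K₂]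
    [NumberField K₂], Module.finrank ℚ K₁ = 2 → Module.finrank ℚ K₂ = 2 →
    NumberField.discr K₁ < 0 → NumberField.discr K₂ < 0 →
    C * (h : ℝ) ^ 2 * Real.log (3 * h) ^ 2 < (NumberField.discr K₁).natAbs →
    C * (h : ℝ) ^ 2 * Real.log (3 * h) ^ 2 < (NumberField.discr K₂).natAbs →
    NumberField.discr K₁ ≠ NumberField.discr K₂ →
      h < NumberField.classNumber K₁ ∨ h < NumberField.classNumber K₂

/-! ### PROVED reading -/

namespace Pintz1976Heilbronn

/-- **Theorem 2 unpacked**: given ONE zero `1 − γ + it` (`γ < 0.05`) of some `L(s, χ_k)`, `χ_k ≠ 1`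
mod `k`, every real zero `β < 1` of every real non-principal `χ_D` mod `D > D₀` with `χ_kχ_D`
non-principal satisfies `1 − β > 1/(140 U^{6γ} log⁵U)`, `U = k|1 − γ + it|D` — an explicit,
polynomial-in-`D` floor for `1 − β` (contrast Siegel's ineffective `D^{−ε}`), conditional only on the
existence of that one auxiliary zero. [cite: Pintz1976ElementaryIV, Theorem 2 p. 423 (2.2)] -/
theorem realZero_gt_of_theorem2 (h : pintz1976Heilbronn_theorem2) :
    ∃ D₀ : ℕ, ∀ (k : ℕ) [NeZero k] (χk : DirichletCharacter ℂ k), χk ≠ 1 →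
      ∀ γ t : ℝ, γ < 0.05 → χk.LFunction (1 - γ + t * Complex.I) = 0 →
        ∀ (D : ℕ) [NeZero D] (χD : DirichletCharacter ℂ D), D₀ < D → χD ≠ 1 → χD.IsQuadratic →
          ProductNonprincipal χk χD → ∀ β : ℝ, β < 1 → χD.LFunction (β : ℂ) = 0 →
            1 / (140 * (((k : ℝ) * ‖(1 - γ + t * Complex.I : ℂ)‖ * D) ^ (6 * γ)) *
                Real.log ((k : ℝ) * ‖(1 - γ + t * Complex.I : ℂ)‖ * D) ^ 5) < 1 - β := by
  obtain ⟨D₀, hD₀⟩ := h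
  refine ⟨D₀, fun k _ χk hk γ t hγ hz D _ χD hD hD1 hquad hprod β hβ hzβ => ?_⟩
  have hδ : 0 < 1 - β := by linarith
  have hcast : (((1 - (1 - β) : ℝ) : ℂ)) = (β : ℂ) := by push_cast; ring
  have hz' : χD.LFunction (((1 - (1 - β) : ℝ) : ℂ)) = 0 := by rw [hcast]; exact hzβ
  exact hD₀ k χk hk γ t hγ hz D χD hD hD1 hquad hprod (1 - β) hδ hz'

end Pintz1976Heilbronn

end Literature.NumberTheory.LFunctions

end
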